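import Mathlib
import HarnessLib
import Summits.Ventures.LatticeQCDFlow.Exactness.OpenBoundaryTimeReflection
import Literature.Barriers.QuantumFields.CenterSymmetryBreakingByQuarks

/-!
# Centre symmetry survives plaquette weights: `⟨tr P⟩ = 0` for the Polyakov loop under the open-boundary (and every plaquette-weighted) `SU(N)` Gibbs law

HONEST FRAMING: exact (Metropolis-corrected) sampling algorithms for lattice gauge theory;
figures of merit are autocorrelation/cost numbers at stated couplings and volumes; no
continuum-physics claim.

Venture `LatticeQCDFlow` (cell pub-lqcd), topic `Exactness`, FANOUT row 21 (`su3-base`, arm `OBC-HMC`; the plaquette-weighted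
form also covers the defect weights of rows 22–24).  NEW WORK of the cell over the Literature's centre symmetry of pure gauge
theory on the torus (`Literature/Barriers/QuantumFields/CenterSymmetryBreakingByQuarks`: `centerTwist z t₀` — `U₀(x⃗, t₀) ↦ z U₀(x⃗, t₀)`
on one time slice for a central `z` —, `plaquetteHolonomy_centerTwist` (every plaquette is centre-blind), `map_centerTwist_pi_haar`,
`integral_eq_zero_of_covariant`, `tracePolyakov`, `isCenterCovariant_tracePolyakov`, and the torus statement
`wilsonExpectation_tracePolyakov_eq_zero`) and the cell's `weightedWilsonAction` / `obcAction` / `gibbsProbability`.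
The observation: the twist changes NO plaquette, so it is a symmetry of EVERY plaquette-weighted Wilson action, whatever the
weights — open boundaries (weights `0, ½, 1`) and parallel-tempering defects (weights `c ∈ [0, 1]`) included.  Nothing is cited
as a fact; no number.

## What is proved (every `d ≥ 1`, `L ≥ 1`, compact `G`, central `z`, slice `t₀`, every real `β`)

* §1 `weightedWilsonAction_centerTwist` — `S_w(zU) = S_w(U)` for EVERY weight `w`; `obcAction_centerTwist` (every open direction `τ`).
* §2 **`weightedGibbs_map_centerTwist`** — the Gibbs law `Z⁻¹ e^{−S_w} ∏ dHaar` of every plaquette-weighted action is twist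
  invariant; **`obcGibbs_map_centerTwist`** — so is the open-boundary Gibbs law of every direction `τ` and coupling `β`;
  `weightedGibbs_integral_eq_zero_of_centerCovariant` / `obcGibbs_integral_eq_zero_of_centerCovariant` — every observable with
  `F(zU) = ω F(U)`, `ω ≠ 1`, has expectation `0` under them (no integrability needed).
* §3 `SU(N)`, `N ≥ 2`: **`obcGibbs_tracePolyakov_integral_eq_zero`** — `⟨tr P(y)⟩_OBC = 0` for the traced fundamental Polyakov loop in
  the time direction `0`, for EVERY open direction `τ` (for `τ ≠ 0` the loop winds around a periodic direction of the open lattice;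
  for `τ = 0` it crosses the dropped links and the statement is the trivial one), every `β`, volume and base site;
  `weightedGibbs_tracePolyakov_integral_eq_zero` — the same under every plaquette-weighted `SU(N)` law.
  So in an open-boundary `SU(3)` run a measured `⟨tr P⟩ ≠ 0` beyond errors indicts the sampler or the estimator, never the target.

NOT CLAIMED: anything about `|P|`, Polyakov-loop correlators or the susceptibility; the sampler (the open-boundary HMC kernel is
not typed in the tree; the torus kernel's twist covariance is `Scoring/HMCKernelCenterSymmetry`); numbers.
-/

noncomputable section

namespace Summit.Ventures.LatticeQCDFlow.Exactness

open MeasureTheory Set Function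
open Literature.MathematicalPhysics.QuantumFieldTheory
open Literature.Barriers.QuantumFields (centerTwist centerTwistEquiv centerTwistEquiv_apply plaquetteHolonomy_centerTwist
  map_centerTwist_pi_haar integral_eq_zero_of_covariant tracePolyakov isCenterCovariant_tracePolyakov)

/-! ## §1 Every plaquette-weighted action is twist invariant -/

section Action

variable {d L N : ℕ} [NeZero d] [NeZero L] {G : Type*} [Group G] (ρ : G →* Matrix (Fin N) (Fin N) ℂ) {z : G}

/-- **`S_w(zU) = S_w(U)` for EVERY plaquette weight `w`**: the centre twist changes no plaquette. -/
theorem weightedWilsonAction_centerTwist (hz : z ∈ Subgroup.center G) (w : Plaquette d L → ℝ) (t₀ : ZMod L)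
    (U : GaugeConfig d L G) : weightedWilsonAction w ρ (centerTwist z t₀ U) = weightedWilsonAction w ρ U := by
  simp only [weightedWilsonAction, plaquetteHolonomy_centerTwist hz]

/-- The open-boundary action of every direction is twist invariant. -/
theorem obcAction_centerTwist (hz : z ∈ Subgroup.center G) (τ : Fin d) (t₀ : ZMod L) (U : GaugeConfig d L G) :
    obcAction ρ τ (centerTwist z t₀ U) = obcAction ρ τ U :=
  weightedWilsonAction_centerTwist ρ hz (obcWeight τ) t₀ U

end Action

/-! ## §2 The weighted and open-boundary Gibbs laws are twist invariant; covariant observables average to zero -/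

section Measures

variable {d L N : ℕ} [NeZero d] [NeZero L] {G : Type*} [Group G] [TopologicalSpace G] [IsTopologicalGroup G] [CompactSpace G]
  [MeasurableSpace G] [BorelSpace G] (ρ : G →* Matrix (Fin N) (Fin N) ℂ) {z : G}

/-- **The Gibbs law of EVERY plaquette-weighted Wilson action is centre symmetric** (compact `G`, central `z`, every slice;
no continuity of `ρ` needed). -/
theorem weightedGibbs_map_centerTwist (hz : z ∈ Subgroup.center G) (w : Plaquette d L → ℝ) (t₀ : ZMod L) :
    (gibbsProbability (Measure.pi fun _ : Edge d L => haarProbability G) (fun U => Real.exp (-weightedWilsonAction w ρ U))).map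
        (centerTwistEquiv z t₀) =
      gibbsProbability (Measure.pi fun _ : Edge d L => haarProbability G) (fun U => Real.exp (-weightedWilsonAction w ρ U)) := by
  unfold gibbsProbability
  rw [Measure.map_smul]
  congr 1
  exact WilsonGauge.withDensity_map_equiv_of_invariant _ _ _ (map_centerTwist_pi_haar z t₀)
    fun U => by beta_reduce; rw [centerTwistEquiv_apply, weightedWilsonAction_centerTwist ρ hz]

/-- **THE OPEN-BOUNDARY GIBBS LAW OF EVERY DIRECTION IS CENTRE SYMMETRIC** (compact `G`, central `z`, every `β`, every slice). -/
theorem obcGibbs_map_centerTwist (hz : z ∈ Subgroup.center G) (τ : Fin d) (β : ℝ) (t₀ : ZMod L) :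
    (gibbsProbability (Measure.pi fun _ : Edge d L => haarProbability G) (fun U => Real.exp (-(β * obcAction ρ τ U)))).map
        (centerTwistEquiv z t₀) =
      gibbsProbability (Measure.pi fun _ : Edge d L => haarProbability G) (fun U => Real.exp (-(β * obcAction ρ τ U))) := by
  unfold gibbsProbability
  rw [Measure.map_smul]
  congr 1
  exact WilsonGauge.withDensity_map_equiv_of_invariant _ _ _ (map_centerTwist_pi_haar z t₀)
    fun U => by beta_reduce; rw [centerTwistEquiv_apply, obcAction_centerTwist ρ hz]

/-- **The order-parameter mechanism under every weighted law**: `F(zU) = ω F(U)` with `ω ≠ 1` forces `∫ F = 0`. -/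
theorem weightedGibbs_integral_eq_zero_of_centerCovariant (hz : z ∈ Subgroup.center G) (w : Plaquette d L → ℝ) (t₀ : ZMod L)
    (F : GaugeConfig d L G → ℂ) {ω : ℂ} (hω : ω ≠ 1) (hF : ∀ U, F (centerTwist z t₀ U) = ω * F U) :
    ∫ U, F U ∂(gibbsProbability (Measure.pi fun _ : Edge d L => haarProbability G)
        (fun U => Real.exp (-weightedWilsonAction w ρ U))) = 0 :=
  integral_eq_zero_of_covariant (centerTwistEquiv z t₀) (weightedGibbs_map_centerTwist ρ hz w t₀) F hω hF

/-- **The order-parameter mechanism under the open-boundary law** of every direction and coupling. -/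
theorem obcGibbs_integral_eq_zero_of_centerCovariant (hz : z ∈ Subgroup.center G) (τ : Fin d) (β : ℝ) (t₀ : ZMod L)
    (F : GaugeConfig d L G → ℂ) {ω : ℂ} (hω : ω ≠ 1) (hF : ∀ U, F (centerTwist z t₀ U) = ω * F U) :
    ∫ U, F U ∂(gibbsProbability (Measure.pi fun _ : Edge d L => haarProbability G)
        (fun U => Real.exp (-(β * obcAction ρ τ U)))) = 0 :=
  integral_eq_zero_of_covariant (centerTwistEquiv z t₀) (obcGibbs_map_centerTwist ρ hz τ β t₀) F hω hF

end Measures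

/-! ## §3 `SU(N)`, `N ≥ 2`: the Polyakov loop averages to zero under the open-boundary and every weighted law -/

section SU

open Literature.MathematicalPhysics.QuantumLattice (fundamentalRep)

variable {d L : ℕ} [NeZero d] [NeZero L] {N : ℕ}

/-- **`⟨tr P(y)⟩_OBC = 0`** for the traced fundamental Polyakov loop (time direction `0`) of `SU(N)`, `N ≥ 2`, under the open-boundary
Gibbs law of EVERY direction `τ`, every `β`, every volume and base site. -/
theorem obcGibbs_tracePolyakov_integral_eq_zero (hN : 2 ≤ N) (τ : Fin d) (β : ℝ) (y : Site d L) :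
    ∫ U, tracePolyakov N y U ∂(gibbsProbability
        (Measure.pi fun _ : Edge d L => haarProbability (Matrix.specialUnitaryGroup (Fin N) ℂ))
        (fun U => Real.exp (-(β * obcAction (fundamentalRep (Fin N)) τ U)))) = 0 := by
  obtain ⟨z, ω, hz, hω, hF⟩ := isCenterCovariant_tracePolyakov (d := d) (L := L) hN y
  exact obcGibbs_integral_eq_zero_of_centerCovariant (fundamentalRep (Fin N)) hz τ β 0 (tracePolyakov N y) hω (hF 0)

/-- **`⟨tr P(y)⟩ = 0` under EVERY plaquette-weighted `SU(N)` law** (`N ≥ 2`; e.g. the defect laws of parallel tempering in the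
boundary conditions), every volume and base site. -/
theorem weightedGibbs_tracePolyakov_integral_eq_zero (hN : 2 ≤ N) (w : Plaquette d L → ℝ) (y : Site d L) :
    ∫ U, tracePolyakov N y U ∂(gibbsProbability
        (Measure.pi fun _ : Edge d L => haarProbability (Matrix.specialUnitaryGroup (Fin N) ℂ))
        (fun U => Real.exp (-weightedWilsonAction w (fundamentalRep (Fin N)) U))) = 0 := by
  obtain ⟨z, ω, hz, hω, hF⟩ := isCenterCovariant_tracePolyakov (d := d) (L := L) hN y
  exact weightedGibbs_integral_eq_zero_of_centerCovariant (fundamentalRep (Fin N)) hz w 0 (tracePolyakov N y) hω (hF 0)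

end SU

end Summit.Ventures.LatticeQCDFlow.Exactness
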